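import Summits.NavierStokesRegularity.NavierStokesRegularity.Theorems.OddMorawetzLocal.Negative.OddMorawetzLocalRefutationData3
import Summits.NavierStokesRegularity.NavierStokesRegularity.Theorems.OddMorawetzLocal.Negative.OddMorawetzLocalRefutationDefsIV
import HarnessLib

/-!
# Crux `OddMorawetzLocal` (stmt-NavierStokesRegularity-1376) — kernel certificates, weight 3 (part B)

The finite computations of the weight-3 half of the refutation, each a closed Boolean evaluated by the kernel
(`decide +kernel`) on the vocabulary of `OddMorawetzLocalJetAlgebra` / `…RefutationDefs{,Fast,IV}` and the literal
data of `…RefutationData3`.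
Part B: `cert3_block_*` — the three block certificates `blockCheck` of the derivation matrix `der lieZ` on the orbit sums
(ranks 6, 12, 5; modular rank certificate, prime 8191) and `cert3_shape` (the derivation columns stay in their shape
block); `cert3_iso_der_*`, `cert3_iso_recon_*` — every element of the isotropic basis `isoDesc3` is killed by the
derivation and is reconstructed from its orbit coordinates; `cert3_iso_cert` — the modular independence certificate of
the isotropic basis in orbit coordinates; `cert3_iso_ideal` — the `ideal` elements vanish on divergence-free jets;
`cert3_iso_canonical` — every monomial of every isotropic basis element is canonical of weight 3 with three factors of
jet order ≤ 3 (a basis monomial, by `idx_complete`); `cert3_live_poly` — the live element (`isoDesc3[0]`, the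
`R`-density `Σ ωᵢ ωⱼ ∂ᵢuⱼ`) as an explicit list.
No analysis; lands `--supports` the crux item; consumed by the weight-3 assembly (steps E1/E2/null of the refutation).
-/

set_option linter.dupNamespace false

namespace Summit.NavierStokesRegularity.NavierStokesRegularity.Theorems.OddMorawetz

/-! ### E2: block certificates of the derivation matrix -/

/-- Block 0 (shape `(0,0,3)`, rank 6): minor × inverse = 1 mod 8191. -/
theorem cert3_block_0 : blockCheck 3 lieZ reps3 (blocks3.getD 0 ([], [], [])).1 (blocks3.getD 0 ([], [], [])).2.1
    (blocks3.getD 0 ([], [], [])).2.2 certPrime3 = true := by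
  decide +kernel

/-- Block 1 (shape `(0,1,2)`, rank 12): minor × inverse = 1 mod 8191. -/
theorem cert3_block_1 : blockCheck 3 lieZ reps3 (blocks3.getD 1 ([], [], [])).1 (blocks3.getD 1 ([], [], [])).2.1
    (blocks3.getD 1 ([], [], [])).2.2 certPrime3 = true := by
  decide +kernel

/-- Block 2 (shape `(1,1,1)`, rank 5): minor × inverse = 1 mod 8191. -/
theorem cert3_block_2 : blockCheck 3 lieZ reps3 (blocks3.getD 2 ([], [], [])).1 (blocks3.getD 2 ([], [], [])).2.1
    (blocks3.getD 2 ([], [], [])).2.2 certPrime3 = true := by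
  decide +kernel

/-- The derivation columns of all certificate representatives stay inside their shape block. -/
theorem cert3_shape : colShapePure reps3 (certCols blocks3) = true ∧
    colShapePure reps3 (List.range reps3.length) = true := by
  decide +kernel

/-! ### The isotropic basis -/

/-- Isotropic basis elements `0 … 7` are killed by the derivation `der lieZ`. -/
theorem cert3_iso_der_0 : ((isoDesc3.take 8).all fun d => derKillsF lieZ (isoPolyF d)) = true := by decide +kernel

/-- Isotropic basis elements `8 … 16` are killed by the derivation `der lieZ`. -/
theorem cert3_iso_der_1 : ((isoDesc3.drop 8).all fun d => derKillsF lieZ (isoPolyF d)) = true := by decide +kernel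

/-- Isotropic basis elements `0 … 7` are the combinations of normalised orbit sums given by their orbit coordinates. -/
theorem cert3_iso_recon_0 : ((isoDesc3.take 8).all fun d => orbitReconF reps3 (isoPolyF d)) = true := by
  decide +kernel

/-- Isotropic basis elements `8 … 16` are the combinations of normalised orbit sums given by their orbit coordinates. -/
theorem cert3_iso_recon_1 : ((isoDesc3.drop 8).all fun d => orbitReconF reps3 (isoPolyF d)) = true := by
  decide +kernel

/-- The modular independence certificate of the isotropic basis in orbit coordinates: `S_K · C = 1 (mod 8191)`. -/
theorem cert3_iso_cert : isoCertCheck reps3 isoDesc3 kcols3 cinv3 certPrime3 = true := by decide +kernel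

/-- The `ideal` elements of the isotropic basis lie in the divergence-free differential ideal. -/
theorem cert3_iso_ideal :
    (isoDesc3.all fun d => match d with
      | .ideal sh m => nfKillsF (isoPolyF (.ideal sh m))
      | _ => true) = true := by
  decide +kernel

/-- Every monomial of every isotropic basis element is canonical: variables sorted, three factors, sorted index lists
of length ≤ 3, total derivative weight 3. -/
theorem cert3_iso_canonical :
    (isoDesc3.all fun d => (isoPolyF d).all fun t =>
      decide (sortVars t.2 = t.2) && decide (t.2.length = 3) && decide (monoWeight t.2 = 3) &&
        t.2.all fun v => decide (sortIdx v.2 = v.2) && decide (v.2.length ≤ 3)) = true := by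
  decide +kernel

/-- The live isotropic element (the `R`-density `Σᵢⱼ ωᵢ ωⱼ ∂ᵢ uⱼ`, `ω = curl u`) as an explicit normalised list. -/
theorem cert3_live_poly : isoPolyF (isoDesc3.getD 0 (.poly [])) =
    [(1, [(0, [0]), (1, [2]), (1, [2])]), (-2, [(0, [0]), (1, [2]), (2, [1])]), (1, [(0, [0]), (2, [1]), (2, [1])]),
      (1, [(0, [1]), (0, [1]), (2, [2])]), (-1, [(0, [1]), (0, [2]), (1, [2])]), (-1, [(0, [1]), (0, [2]), (2, [1])]),
      (-2, [(0, [1]), (1, [0]), (2, [2])]), (3, [(0, [1]), (1, [2]), (2, [0])]), (-1, [(0, [1]), (2, [0]), (2, [1])]),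
      (1, [(0, [2]), (0, [2]), (1, [1])]), (-1, [(0, [2]), (1, [0]), (1, [2])]), (3, [(0, [2]), (1, [0]), (2, [1])]),
      (-2, [(0, [2]), (1, [1]), (2, [0])]), (1, [(1, [0]), (1, [0]), (2, [2])]), (-1, [(1, [0]), (1, [2]), (2, [0])]),
      (-1, [(1, [0]), (2, [0]), (2, [1])]), (1, [(1, [1]), (2, [0]), (2, [0])])] := by
  decide +kernel

/-- The descriptors `1 … 16` of the weight-3 isotropic basis are `null` or `ideal` (only element `0` is live). -/
theorem cert3_iso_kinds : ((isoDesc3.drop 1).all fun d => match d with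
      | .null _ _ => true
      | .ideal _ _ => true
      | _ => false) = true := by
  decide +kernel

end Summit.NavierStokesRegularity.NavierStokesRegularity.Theorems.OddMorawetz
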